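import Summits.Ventures.PercRepro.S1NineSixRankSevenNine

/-!
# PercRepro — THE RANK CLASSES OF A COLOOP-FREE SIMPLE RANK-7 MATROID ON 10 POINTS (p2, gen 28; SUBCLAIM-S1
§6.10 (xvii)(q); towards the `(9, 6)` shapes)

Closures of pairs have `≤ 4` points (`c = 2`), so a rank-`m` set (`m < 7`) has `≤ m + 2` points. The `k`-sets
are partitioned by rank into `rankTwoSets k`, `rkSets k 3`, …, `rkSets k 7`; emptiness by size and by rank; the
partitions as lower bounds `C(10, k) ≤ Σ` with the empty classes removed. Nothing is claimed about any cell.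

Axioms: standard.
-/

open scoped Matroid

namespace PercRepro

namespace S1

open Set

variable {α : Type} {M : Matroid α} [M.Finite]

/-- The rank of a `k`-set as a natural with its bounds, on `10` points of rank `7`. -/
theorem eRk_bounds_ten_seven (hM : M.eRank = ((7 : ℕ) : ℕ∞)) (hE : M.E.ncard = 10) (hcol : M.coloops = ∅)
    (hpairs : ∀ e ∈ M.E, ∀ f ∈ M.E, e ≠ f → M.eRk {e, f} = 2) {X : Set α} (hX : X ⊆ M.E) (h2 : 2 ≤ X.ncard) :
    ∃ m : ℕ, M.eRk X = (m : ℕ∞) ∧ 2 ≤ m ∧ m ≤ 7 ∧ m ≤ X.ncard ∧ (m < 7 → X.ncard + (7 - m + 1) ≤ 10) := by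
  have hhi : M.eRk X ≤ M.eRank := M.eRk_le_eRank X
  rw [hM] at hhi
  obtain ⟨m, hm⟩ := ENat.ne_top_iff_exists.mp (ne_top_of_le_ne_top (by decide) hhi)
  have hlo := two_le_eRk_of_two_le_ncard hpairs hX h2
  have hsize : M.eRk X ≤ (X.ncard : ℕ∞) := by
    have := M.eRk_le_encard X
    rwa [← (M.ground_finite.subset hX).cast_ncard_eq] at this
  rw [← hm] at hlo hhi hsize
  refine ⟨m, hm.symm, by exact_mod_cast hlo, by exact_mod_cast hhi, by exact_mod_cast hsize, fun h => ?_⟩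
  have hmiss := sub_add_one_le_ncard_ground_sdiff_of_coloops M hM hcol hX hm.symm h
  rw [ncard_sdiff' hX M.ground_finite, hE] at hmiss
  have := ncard_le_ncard hX M.ground_finite
  rw [hE] at this
  omega

/-- A `k`-set (`k ≥ 2`) lies in one of the rank classes. -/
theorem mem_rank_classes_ten_seven (hM : M.eRank = ((7 : ℕ) : ℕ∞)) (hE : M.E.ncard = 10) (hcol : M.coloops = ∅)
    (hpairs : ∀ e ∈ M.E, ∀ f ∈ M.E, e ≠ f → M.eRk {e, f} = 2) {X : Set α} (hX : X ⊆ M.E) (h2 : 2 ≤ X.ncard) :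
    X ∈ rankTwoSets M X.ncard ∪ rkSets M X.ncard 3 ∪ rkSets M X.ncard 4 ∪ rkSets M X.ncard 5 ∪ rkSets M X.ncard 6 ∪ rkSets M X.ncard 7 := by
  obtain ⟨m, hm, hm2, hmr, -, -⟩ := eRk_bounds_ten_seven hM hE hcol hpairs hX h2
  have key : ∀ j : ℕ, m = j → X ∈ rkSets M X.ncard j := fun j hj => ⟨hX, rfl, by rw [hm, hj]⟩
  rcases Nat.lt_or_ge m 3 with h2 | h2
  · left; left; left; left; left; refine ⟨hX, rfl, ?_⟩; rw [hm]; have : m = 2 := by omega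
    rw [this]; rfl
  rcases Nat.lt_or_ge m 4 with h3 | h3
  · left; left; left; left; right; exact key 3 (by omega)
  rcases Nat.lt_or_ge m 5 with h4 | h4
  · left; left; left; right; exact key 4 (by omega)
  rcases Nat.lt_or_ge m 6 with h5 | h5
  · left; left; right; exact key 5 (by omega)
  rcases Nat.lt_or_ge m 7 with h6 | h6
  · left; right; exact key 6 (by omega)
  · right; exact key 7 (by omega)

/-- The `k`-sets are covered by the rank classes. -/
theorem choose_le_rank_classes_ten_seven (hM : M.eRank = ((7 : ℕ) : ℕ∞)) (hE : M.E.ncard = 10) (hcol : M.coloops = ∅)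
    (hpairs : ∀ e ∈ M.E, ∀ f ∈ M.E, e ≠ f → M.eRk {e, f} = 2) (k : ℕ) (hk : 2 ≤ k) :
    Nat.choose 10 k ≤ (rankTwoSets M k).ncard + (rkSets M k 3).ncard + (rkSets M k 4).ncard + (rkSets M k 5).ncard + (rkSets M k 6).ncard + (rkSets M k 7).ncard := by
  have hsub : {A : Set α | A ⊆ M.E ∧ A.ncard = k} ⊆ rankTwoSets M k ∪ rkSets M k 3 ∪ rkSets M k 4 ∪ rkSets M k 5 ∪ rkSets M k 6 ∪ rkSets M k 7 := by
    rintro A ⟨hAE, hAk⟩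
    have := mem_rank_classes_ten_seven hM hE hcol hpairs hAE (by omega)
    rwa [hAk] at this
  have h := ncard_le_ncard hsub ((((((rankTwoSets_finite M k).union (rkSets_finite k 3)).union (rkSets_finite k 4)).union (rkSets_finite k 5)).union (rkSets_finite k 6)).union (rkSets_finite k 7))
  rw [ncard_setOf_subset_ncard_eq M.ground_finite k, hE] at h
  refine h.trans ?_
  refine (ncard_union_le _ _).trans ?_
  refine Nat.add_le_add_right ((ncard_union_le _ _).trans ?_) _
  refine Nat.add_le_add_right ((ncard_union_le _ _).trans ?_) _
  refine Nat.add_le_add_right ((ncard_union_le _ _).trans ?_) _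
  exact Nat.add_le_add_right (ncard_union_le _ _) _

/-- A rank-`m` set (`m < 7`) has at most `m + 2` points. -/
theorem rkSets_eq_empty_of_big_ten_seven (hM : M.eRank = ((7 : ℕ) : ℕ∞)) (hE : M.E.ncard = 10) (hcol : M.coloops = ∅)
    {k m : ℕ} (hm : m < 7) (hk : 10 < k + (7 - m + 1)) : rkSets M k m = ∅ := by
  rw [eq_empty_iff_forall_notMem]
  rintro X ⟨hXE, hXk, hXm⟩
  have hmiss := sub_add_one_le_ncard_ground_sdiff_of_coloops M hM hcol hXE hXm hm
  rw [ncard_sdiff' hXE M.ground_finite, hE, hXk] at hmiss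
  have := ncard_le_ncard hXE M.ground_finite
  rw [hE] at this
  omega

/-- No rank-`2` set has more than `4` points. -/
theorem rankTwoSets_eq_empty_of_big_ten_seven (hM : M.eRank = ((7 : ℕ) : ℕ∞)) (hE : M.E.ncard = 10)
    (hcol : M.coloops = ∅) {k : ℕ} (hk : 4 < k) : rankTwoSets M k = ∅ := by
  rw [eq_empty_iff_forall_notMem]
  rintro X ⟨hXE, hXk, hX2⟩
  have hX2' : M.eRk X = ((2 : ℕ) : ℕ∞) := hX2
  have hmiss := sub_add_one_le_ncard_ground_sdiff_of_coloops M hM hcol hXE hX2' (by norm_num)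
  rw [ncard_sdiff' hXE M.ground_finite, hE, hXk] at hmiss
  have := ncard_le_ncard hXE M.ground_finite
  rw [hE] at this
  omega

/-- The partitions of the `k`-sets by rank (`k = 3, …, 9`) with the empty classes removed, as lower bounds. -/
theorem rank_classes_ten_seven (hM : M.eRank = ((7 : ℕ) : ℕ∞)) (hE : M.E.ncard = 10) (hcol : M.coloops = ∅)
    (hpairs : ∀ e ∈ M.E, ∀ f ∈ M.E, e ≠ f → M.eRk {e, f} = 2) :
    120 ≤ (rankTwoSets M 3).ncard + (rkSets M 3 3).ncard ∧
    210 ≤ (rankTwoSets M 4).ncard + (rkSets M 4 3).ncard + (rkSets M 4 4).ncard ∧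
    252 ≤ (rkSets M 5 3).ncard + (rkSets M 5 4).ncard + (rkSets M 5 5).ncard ∧
    210 ≤ (rkSets M 6 4).ncard + (rkSets M 6 5).ncard + (rkSets M 6 6).ncard ∧
    120 ≤ (rkSets M 7 5).ncard + (rkSets M 7 6).ncard + (rkSets M 7 7).ncard ∧
    45 ≤ (rkSets M 8 6).ncard + (rkSets M 8 7).ncard ∧
    10 ≤ (rkSets M 9 7).ncard := by
  have e_lt : ∀ {k n : ℕ}, k < n → rkSets M k n = ∅ := fun h => rkSets_eq_empty_of_lt h
  have e_big := fun {k n : ℕ} (hn : n < 7) (hk : 10 < k + (7 - n + 1)) =>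
    rkSets_eq_empty_of_big_ten_seven hM hE hcol (k := k) (m := n) hn hk
  have e_two := fun {k : ℕ} (hk : 4 < k) => rankTwoSets_eq_empty_of_big_ten_seven hM hE hcol (k := k) hk
  refine ⟨?_, ?_, ?_, ?_, ?_, ?_, ?_⟩
  · have := choose_le_rank_classes_ten_seven hM hE hcol hpairs 3 (by norm_num)
    rw [e_lt (k := 3) (n := 4) (by norm_num), e_lt (k := 3) (n := 5) (by norm_num), e_lt (k := 3) (n := 6) (by norm_num), e_lt (k := 3) (n := 7) (by norm_num), ncard_empty, show Nat.choose 10 3 = 120 by decide] at this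
    omega
  · have := choose_le_rank_classes_ten_seven hM hE hcol hpairs 4 (by norm_num)
    rw [e_lt (k := 4) (n := 5) (by norm_num), e_lt (k := 4) (n := 6) (by norm_num), e_lt (k := 4) (n := 7) (by norm_num), ncard_empty, show Nat.choose 10 4 = 210 by decide] at this
    omega
  · have := choose_le_rank_classes_ten_seven hM hE hcol hpairs 5 (by norm_num)
    rw [e_two (k := 5) (by norm_num), e_lt (k := 5) (n := 6) (by norm_num), e_lt (k := 5) (n := 7) (by norm_num), ncard_empty, show Nat.choose 10 5 = 252 by decide] at this
    omega
  · have := choose_le_rank_classes_ten_seven hM hE hcol hpairs 6 (by norm_num)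
    rw [e_two (k := 6) (by norm_num), e_big (k := 6) (n := 3) (by norm_num) (by norm_num), e_lt (k := 6) (n := 7) (by norm_num), ncard_empty, show Nat.choose 10 6 = 210 by decide] at this
    omega
  · have := choose_le_rank_classes_ten_seven hM hE hcol hpairs 7 (by norm_num)
    rw [e_two (k := 7) (by norm_num), e_big (k := 7) (n := 3) (by norm_num) (by norm_num), e_big (k := 7) (n := 4) (by norm_num) (by norm_num), ncard_empty, show Nat.choose 10 7 = 120 by decide] at this
    omega
  · have := choose_le_rank_classes_ten_seven hM hE hcol hpairs 8 (by norm_num)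
    rw [e_two (k := 8) (by norm_num), e_big (k := 8) (n := 3) (by norm_num) (by norm_num), e_big (k := 8) (n := 4) (by norm_num) (by norm_num), e_big (k := 8) (n := 5) (by norm_num) (by norm_num), ncard_empty, show Nat.choose 10 8 = 45 by decide] at this
    omega
  · have := choose_le_rank_classes_ten_seven hM hE hcol hpairs 9 (by norm_num)
    rw [e_two (k := 9) (by norm_num), e_big (k := 9) (n := 3) (by norm_num) (by norm_num), e_big (k := 9) (n := 4) (by norm_num) (by norm_num), e_big (k := 9) (n := 5) (by norm_num) (by norm_num), e_big (k := 9) (n := 6) (by norm_num) (by norm_num), ncard_empty, show Nat.choose 10 9 = 10 by decide] at this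
    omega

end S1

end PercRepro
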